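import Literature.Computability.Complexity.TM2Circuits
import HarnessLib

/-!
# Rows of the Cook–Levin tableau for Mathlib's `FinTM2`: the step as an explicit local rule

Toolkit for the Cook–Levin theorem over the machine model of the H21 complexity classes
(Mathlib's multi-stack machines `Turing.FinTM2`). A *row* of the tableau of a configuration
`c` is the sequence of *blocks* `absVal c 0, absVal c 1, …` with values in the finite type
`Val tm = Ctrl tm × Cell tm` (`TM2Circuits.lean`): block `0` carries the control
`(label, internal state)`, block `J + 1` carries cell `J`, i.e. for every stack the symbol at depth
`J` below its top (`none` below the bottom), restricted to the finite effective alphabets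
(`FinTM2Sim.toSym`). Cells are indexed by `ℕ` (no capacity), so that nothing is ever cut off.

From the window lemma of `TM2Window.lean` (`TM2Sim.getElem?_stepTotal_stk`: after one step, cell
`j` of stack `k` is cell `j` of the new window `W'ₖ` computed on the top-`d` truncation if
`j < |W'ₖ|`, and the old cell `j - |W'ₖ| + d` otherwise) we derive the two **local rules** of the
tableau (Sipser 2012, proof of Thm. 9.30: "each entry is determined by the window above it";
Arora–Barak 2009, proof of Thm. 2.10, Claim 2.11.1: a snapshot is determined by the previous
snapshots; Cook 1971, proof of Thm. 1), in `TM2` form and for any `d ≥ depth tm`: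

* `topF d a` — the new blocks `0 … 2d` as a function of the old blocks `0 … 3d`
  (`absVal_stepTotal_top`);
* `intF d h nb` — the new block `J ≥ 2d + 1` as a function of the old head blocks `0 … d` and
  the old neighbourhood blocks `J - d … J + d` (`absVal_stepTotal_int`).

Both are *finite functions* (finitely many arguments from the finite type `Val tm`), which is
what a propositional tableau formula can tabulate. The rows of Mathlib's initial and halting
configurations are computed (`absVal_initList_succ`, `absVal_haltList_one`), and blocks below the
stacks are empty (`absVal_eq_noneVal`).

## References

* M. Sipser, *Introduction to the Theory of Computation*, 3rd ed., Cengage 2012, Thm. 7.37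
  (Cook–Levin) and Thm. 9.30 (tableau, windows).
* S. Arora, B. Barak, *Computational Complexity: A Modern Approach*, CUP 2009, Thm. 2.10,
  Lemma 2.11, Claim 2.11.1 (snapshots), proof of Thm. 6.6.
* S. A. Cook, *The complexity of theorem-proving procedures*, Proc. 3rd STOC (1971), 151–158,
  Thm. 1.
-/

namespace Literature.Computability.Complexity

namespace Tableau

open Turing FinTM2Sim

variable (tm : FinTM2)

attribute [local instance] Turing.FinTM2.kFin Turing.FinTM2.ΛFin Turing.FinTM2.σFin
  Turing.FinTM2.Γk₀Fin

/-- Block values of the tableau: a control together with a cell (Sipser 2012, proof of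
Thm. 9.30: the entries of a row). [cite: Sipser2012, Thm. 9.30 (proof)] -/
abbrev Val : Type := Ctrl tm × Cell tm

/-- Block values form a finite type. [folklore] -/
instance : Finite (Val tm) := inferInstance

/-- The empty cell (every stack is shorter than this depth). [folklore] -/
def noneCell : Cell tm := fun _ => none

/-- The empty block `(default control, empty cell)`. [folklore] -/
def noneVal : Val tm := (default, noneCell tm)

variable {tm}

/-- Cell `i` of a family of stacks: for every stack the (effective) symbol at depth `i`, `none`
below the bottom; the `ℕ`-indexed form of `FinTM2Sim.absCells`. [cite: Sipser2012, Thm. 9.30 (proof)] -/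
noncomputable def cellAt (stk : ∀ k, List (tm.Γ k)) (i : ℕ) : Cell tm :=
  fun k => ((stk k)[i]?).bind (toSym tm k)

/-- **The row of a configuration**: block `0` is `(control, empty cell)`, block `J + 1` is
`(default, cell J)`. [cite: Sipser2012, Thm. 9.30 (proof)] -/
noncomputable def absVal (c : tm.Cfg) (J : ℕ) : Val tm :=
  if J = 0 then ((c.l, c.var), noneCell tm) else (default, cellAt c.stk (J - 1))

/-- Block `0` of a row. [folklore] -/
@[simp] theorem absVal_zero (c : tm.Cfg) : absVal c 0 = ((c.l, c.var), noneCell tm) := rfl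

/-- Block `J + 1` of a row. [folklore] -/
@[simp] theorem absVal_succ (c : tm.Cfg) (J : ℕ) :
    absVal c (J + 1) = (default, cellAt c.stk J) := by
  simp [absVal]

/-- `toSym` hits exactly the effective symbol it is applied to. [folklore] -/
theorem toSym_eq_some_iff {k : tm.K} (γ : tm.Γ k) (s : StackSym tm k) :
    toSym tm k γ = some s ↔ s.1 = γ := by
  classical
  unfold toSym
  split
  · next h =>
    constructor
    · intro e; cases e; rfl
    · intro e; congr 1; exact Subtype.ext e.symm
  · next h =>
    constructor
    · intro e; cases e
    · intro e; exact absurd (e ▸ s.2) h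

/-- `toSym` is `none` exactly off the effective alphabet. [folklore] -/
theorem toSym_eq_none_iff {k : tm.K} (γ : tm.Γ k) :
    toSym tm k γ = none ↔ ¬ TM2Sim.IsSym tm k γ := by
  classical
  unfold toSym
  split <;> simp_all

/-- On effective symbols `toSym` is injective. [folklore] -/
theorem toSym_injective_of_isSym {k : tm.K} {γ γ' : tm.Γ k} (hγ : TM2Sim.IsSym tm k γ)
    (h : toSym tm k γ = toSym tm k γ') : γ = γ' := by
  rw [toSym_of_isSym tm hγ, eq_comm, toSym_eq_some_iff] at h
  exact h

/-- A cell of a good stack family is empty at stack `k` iff depth `i` is below the bottom of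
stack `k`. [folklore] -/
theorem cellAt_eq_none_iff {stk : ∀ k, List (tm.Γ k)}
    (hg : ∀ k, ∀ γ ∈ stk k, TM2Sim.IsSym tm k γ) (i : ℕ) (k : tm.K) :
    cellAt stk i k = none ↔ (stk k).length ≤ i := by
  unfold cellAt
  cases h : (stk k)[i]? with
  | none => simpa using h
  | some γ =>
    have hi : i < (stk k).length := by
      by_contra hle
      rw [List.getElem?_eq_none (by omega)] at h; cases h
    rw [Option.bind_some, toSym_eq_none_iff]
    exact ⟨fun hn => absurd (hg k γ (List.mem_of_getElem? h)) hn, fun hle => absurd hi (not_lt.2 hle)⟩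

/-- A cell of a good stack family at a depth inside stack `k` holds the symbol there. [folklore] -/
theorem cellAt_of_getElem? {stk : ∀ k, List (tm.Γ k)}
    (hg : ∀ k, ∀ γ ∈ stk k, TM2Sim.IsSym tm k γ) {i : ℕ} {k : tm.K} {γ : tm.Γ k}
    (h : (stk k)[i]? = some γ) :
    cellAt stk i k = some ⟨γ, hg k γ (List.mem_of_getElem? h)⟩ := by
  unfold cellAt
  rw [h, Option.bind_some, toSym_of_isSym]

/-- Below every stack the cells are empty. [folklore] -/
theorem cellAt_eq_noneCell {stk : ∀ k, List (tm.Γ k)} {i : ℕ} (h : ∀ k, (stk k).length ≤ i) :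
    cellAt stk i = noneCell tm := by
  funext k
  simp [cellAt, noneCell, List.getElem?_eq_none (h k)]

/-- Below every stack the blocks of a row are empty. [folklore] -/
theorem absVal_eq_noneVal {c : tm.Cfg} {J : ℕ} (h : ∀ k, (c.stk k).length + 1 ≤ J) :
    absVal c J = noneVal tm := by
  obtain ⟨J, rfl⟩ : ∃ J', J = J' + 1 := ⟨J - 1, by have := h tm.k₀; omega⟩
  rw [absVal_succ, cellAt_eq_noneCell fun k => by have := h k; omega]
  rfl

/-! ### Reading a window back from its cells -/

/-- The stack-`k` symbols of a list of cells, up to the first empty one. [folklore] -/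
noncomputable def cellsToList (k : tm.K) : List (Cell tm) → List (tm.Γ k)
  | [] => []
  | c :: cs => match c k with
    | none => []
    | some γ => γ.1 :: cellsToList k cs

/-- Reading `d` consecutive cells of a good stack family from depth `s` on gives the segment
`((stk k).drop s).take d`. [folklore] -/
theorem cellsToList_map_cellAt {stk : ∀ k, List (tm.Γ k)}
    (hg : ∀ k, ∀ γ ∈ stk k, TM2Sim.IsSym tm k γ) (k : tm.K) :
    ∀ (d s : ℕ), cellsToList k ((List.range' s d).map (cellAt stk)) = ((stk k).drop s).take d
  | 0, s => by simp [cellsToList]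
  | d + 1, s => by
    rw [List.range'_succ, List.map_cons, cellsToList]
    cases h : (stk k)[s]? with
    | none =>
      have hs : (stk k).length ≤ s := by
        by_contra hlt; rw [List.getElem?_eq_getElem (by omega)] at h; cases h
      have : cellAt stk s k = none := (cellAt_eq_none_iff hg s k).2 hs
      simp only [this]
      rw [List.drop_eq_nil_of_le hs, List.take_nil]
    | some γ =>
      rw [cellAt_of_getElem? hg h]
      simp only
      rw [cellsToList_map_cellAt hg k d (s + 1)]
      have hs : s < (stk k).length := by
        by_contra hle; rw [List.getElem?_eq_none (by omega)] at h; cases h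
      rw [List.drop_eq_getElem_cons hs, List.take_succ_cons]
      congr 1
      exact ((List.getElem_eq_iff hs).2 h).symm

/-- The configuration read off the head blocks `0 … d` of a row: control from block `0`, the
top-`d` windows of the stacks from the cells of blocks `1 … d`. [cite: Sipser2012, Thm. 9.30 (proof)] -/
noncomputable def headCfg (d : ℕ) (h : Fin (d + 1) → Val tm) : tm.Cfg :=
  ⟨(h 0).1.1, (h 0).1.2, fun k => cellsToList k ((List.finRange d).map fun r => (h r.succ).2)⟩

/-- **A good configuration truncated to depth `d` is read off the head blocks of its row.**
[cite: Sipser2012, Thm. 9.30 (proof)] -/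
theorem headCfg_absVal (d : ℕ) (c : tm.Cfg) (hg : TM2Sim.Good tm c) :
    headCfg d (fun s => absVal c s) = TM2Sim.truncate tm d c := by
  obtain ⟨l, v, stk⟩ := c
  simp only [headCfg, TM2Sim.truncate, Fin.val_zero, absVal_zero, Fin.val_succ, absVal_succ]
  congr 1
  funext k
  have h1 : ((List.finRange d).map fun r : Fin d => cellAt stk (r : ℕ)) =
      (List.range' 0 d).map (cellAt stk) := by
    rw [List.range'_eq_map_range, ← List.map_coe_finRange_eq_range, List.map_map, List.map_map]
    simp
  rw [h1, cellsToList_map_cellAt hg k d 0, List.drop_zero]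

/-! ### The local rules -/

/-- **Top rule.** The new blocks `0 … 2d` computed from the old blocks `a = (0 … 3d)`: run one
total step on the configuration read off the head blocks; the new control is its control; new
cell `i < 2d` of stack `k` is cell `i` of its new window `W'ₖ` if `i < |W'ₖ|`, and the old cell
`i - |W'ₖ| + d` (block `i - |W'ₖ| + d + 1 ≤ 3d`) otherwise. [cite: Sipser2012, Thm. 9.30 (proof)] -/
noncomputable def topF (d : ℕ) (a : Fin (3 * d + 1) → Val tm) (r : Fin (2 * d + 1)) : Val tm :=
  let c' := TM2Sim.stepTotal tm (headCfg d fun s => a (Fin.castLE (by omega) s))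
  if hr : (r : ℕ) = 0 then ((c'.l, c'.var), noneCell tm)
  else (default, fun k =>
    if (r : ℕ) - 1 < (c'.stk k).length then ((c'.stk k)[(r : ℕ) - 1]?).bind (toSym tm k)
    else (a (⟨(r : ℕ) - 1 - (c'.stk k).length + d + 1, by have := r.2; omega⟩ :
      Fin (3 * d + 1))).2 k)

/-- **Interior rule.** The new block `J ≥ 2d + 1` computed from the old head blocks
`h = (0 … d)` and the old neighbourhood `nb = (J - d … J + d)`: stack `k` is shifted by
`d - |W'ₖ| ∈ [-d, d]`, so the new cell is the old neighbourhood block `2d - |W'ₖ|`.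
[cite: Sipser2012, Thm. 9.30 (proof)] -/
noncomputable def intF (d : ℕ) (h : Fin (d + 1) → Val tm) (nb : Fin (2 * d + 1) → Val tm) : Val tm :=
  let c' := TM2Sim.stepTotal tm (headCfg d h)
  (default, fun k => (nb (⟨2 * d - (c'.stk k).length, by omega⟩ : Fin (2 * d + 1))).2 k)

section Step

variable {d : ℕ} (hd : TM2Sim.depth tm ≤ d) (c : tm.Cfg) (hg : TM2Sim.Good tm c)
include hd hg

/-- **The top rule is correct**: blocks `0 … 2d` of the row of `stepTotal c` are `topF` of blocks
`0 … 3d` of the row of `c`, for good `c` and `d ≥ depth tm` (Sipser 2012, proof of Thm. 9.30;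
Arora–Barak 2009, Claim 2.11.1). [cite: Sipser2012, Thm. 9.30 (proof)] -/
theorem absVal_stepTotal_top (r : Fin (2 * d + 1)) :
    absVal (TM2Sim.stepTotal tm c) r = topF d (fun s => absVal c s) r := by
  have hhead : headCfg d (fun s : Fin (d + 1) => absVal c (Fin.castLE (by omega) s : Fin (3 * d + 1)))
      = TM2Sim.truncate tm d c := headCfg_absVal d c hg
  unfold topF
  simp only [Fin.val_castLE] at hhead ⊢
  rw [hhead]
  rcases Nat.eq_zero_or_pos (r : ℕ) with hr | hr
  · rw [dif_pos hr, hr, absVal_zero]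
    rw [TM2Sim.stepTotal_window tm c d hd]
    rfl
  · obtain ⟨i, hi⟩ : ∃ i, (r : ℕ) = i + 1 := ⟨(r : ℕ) - 1, by omega⟩
    rw [dif_neg (by omega), hi, absVal_succ, Nat.add_sub_cancel]
    congr 1
    funext k
    unfold cellAt
    rw [TM2Sim.getElem?_stepTotal_stk tm c d hd k i]
    split_ifs with hlt
    · rfl
    · have hi2 : i < 2 * d := by have := r.2; omega
      have : i - ((TM2Sim.stepTotal tm (TM2Sim.truncate tm d c)).stk k).length + d + 1 =
          (i - ((TM2Sim.stepTotal tm (TM2Sim.truncate tm d c)).stk k).length + d) + 1 := rfl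
      rw [this, absVal_succ]
      rfl

/-- **The interior rule is correct**: block `J ≥ 2d + 1` of the row of `stepTotal c` is `intF` of
the head blocks `0 … d` and the neighbourhood blocks `J - d … J + d` of the row of `c`
(Sipser 2012, proof of Thm. 9.30; Arora–Barak 2009, Claim 2.11.1). [cite: Sipser2012, Thm. 9.30 (proof)] -/
theorem absVal_stepTotal_int (J : ℕ) (hJ : 2 * d + 1 ≤ J) :
    absVal (TM2Sim.stepTotal tm c) J =
      intF d (fun s => absVal c s) (fun s => absVal c (J - d + s)) := by
  have hhead : headCfg d (fun s : Fin (d + 1) => absVal c s) = TM2Sim.truncate tm d c :=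
    headCfg_absVal d c hg
  unfold intF
  simp only
  rw [hhead]
  obtain ⟨i, rfl⟩ : ∃ i, J = i + 1 := ⟨J - 1, by omega⟩
  rw [absVal_succ]
  congr 1
  funext k
  have hL := TM2Sim.length_stepTotal_truncate_le tm c d hd k
  set L := ((TM2Sim.stepTotal tm (TM2Sim.truncate tm d c)).stk k).length
  have : i + 1 - d + (2 * d - L) = (i - L + d) + 1 := by omega
  rw [this, absVal_succ]
  unfold cellAt
  rw [TM2Sim.getElem?_stepTotal_stk tm c d hd k i, if_neg (by omega)]

end Step

/-! ### Rows of the initial and halting configurations -/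

/-- The cell holding an optional input symbol on the input stack and nothing else.
[folklore] -/
noncomputable def inCell (o : Option (tm.Γ tm.k₀)) : Cell tm :=
  cellAt (Function.update (fun _ => []) tm.k₀ o.toList) 0

/-- The cell holding an optional output symbol on the output stack and nothing else.
[folklore] -/
noncomputable def outCell (o : Option (tm.Γ tm.k₁)) : Cell tm :=
  cellAt (Function.update (fun _ => []) tm.k₁ o.toList) 0

/-- Cells of a single-stack family. [folklore] -/
theorem cellAt_update_nil (k₀ : tm.K) (w : List (tm.Γ k₀)) (i : ℕ) :
    cellAt (Function.update (fun _ => []) k₀ w) i =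
      cellAt (Function.update (fun _ => []) k₀ (w[i]?).toList) 0 := by
  funext k
  unfold cellAt
  by_cases hk : k = k₀
  · subst hk
    simp only [Function.update_self]
    cases w[i]? <;> simp
  · simp [Function.update_of_ne hk]

/-- Block `0` of the initial row: the initial control. [folklore] -/
theorem absVal_initList_zero (w : List (tm.Γ tm.k₀)) :
    absVal (initList tm w) 0 = ((some tm.main, tm.initialState), noneCell tm) := by
  rw [TM2Comp.initList_eq]; rfl

/-- Block `i + 1` of the initial row: the `i`-th input symbol on the input stack. [folklore] -/
theorem absVal_initList_succ (w : List (tm.Γ tm.k₀)) (i : ℕ) :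
    absVal (initList tm w) (i + 1) = (default, inCell (w[i]?)) := by
  rw [TM2Comp.initList_eq, absVal_succ, inCell, cellAt_update_nil]

/-- Block `0` of the halting row. [folklore] -/
theorem absVal_haltList_zero (s : List (tm.Γ tm.k₁)) :
    absVal (haltList tm s) 0 = ((none, tm.initialState), noneCell tm) := by
  rw [TM2Comp.haltList_eq]; rfl

/-- Block `1` of the halting row: the first output symbol on the output stack. [folklore] -/
theorem absVal_haltList_one (s : List (tm.Γ tm.k₁)) :
    absVal (haltList tm s) 1 = (default, outCell (s[0]?)) := by
  rw [TM2Comp.haltList_eq, show (1 : ℕ) = 0 + 1 from rfl, absVal_succ, outCell, cellAt_update_nil]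

/-- Input symbols are effective symbols, so `inCell` is injective. [folklore] -/
theorem inCell_injective : Function.Injective (inCell (tm := tm)) := by
  intro o o' h
  have h0 := congrFun h tm.k₀
  simp only [inCell, cellAt, Function.update_self] at h0
  cases o with
  | none =>
    cases o' with
    | none => rfl
    | some γ' =>
      simp only [Option.toList, List.getElem?_nil, Option.bind_none,
        List.getElem?_cons_zero, Option.bind_some] at h0
      rw [eq_comm, toSym_eq_none_iff] at h0
      exact absurd (Or.inr rfl) h0
  | some γ =>
    cases o' with
    | none =>
      simp only [Option.toList, List.getElem?_nil, Option.bind_none,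
        List.getElem?_cons_zero, Option.bind_some] at h0
      rw [toSym_eq_none_iff] at h0
      exact absurd (Or.inr rfl) h0
    | some γ' =>
      simp only [Option.toList, List.getElem?_cons_zero, Option.bind_some] at h0
      exact congrArg some (toSym_injective_of_isSym (Or.inr rfl) h0)

/-- `outCell` is injective on effective output symbols. [folklore] -/
theorem outCell_some_inj {γ γ' : tm.Γ tm.k₁} (hγ : TM2Sim.IsSym tm tm.k₁ γ)
    (h : outCell (some γ) = outCell (some γ')) : γ = γ' := by
  have h0 := congrFun h tm.k₁
  simp only [outCell, cellAt, Function.update_self, Option.toList, List.getElem?_cons_zero,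
    Option.bind_some] at h0
  exact toSym_injective_of_isSym hγ h0

/-- The empty input cell is the empty cell. [folklore] -/
@[simp] theorem inCell_none : inCell (tm := tm) none = noneCell tm := by
  funext k
  unfold inCell cellAt noneCell
  by_cases hk : k = tm.k₀
  · subst hk; simp
  · simp [Function.update_of_ne hk]

end Tableau

end Literature.Computability.Complexity
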